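import Summits.AtomisticToContinuum.FouriersLaw.Theorems.ParityLiouvilleSeedWindowLimitStationarity
import Summits.AtomisticToContinuum.FouriersLaw.Theorems.ParityLiouvilleSeedWindowLimitWindowGenerator
import Literature.MathematicalPhysics.KineticTheory.ZeroWavenumberSpace

/-!
# The continuity equation of the infinite chain and the currents through the window embedding
(helper for `WindowLimit`)

Helper file for the route item `ParityLiouvilleSeed.WindowLimit` (`stmt-AtomisticToContinuum-13982`).

* `liouvilleZ_energyDensityZ` — the **continuity equation of the infinite chain** in generator form:
  `𝒜 h_x = j_{x-1} - j_x` for the energy density `h_x` (`OscillatorChain.energyDensityZ`, bond energies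
  split evenly) and the bond current `j_x` (`OscillatorChain.bondCurrentZ`), any chain with differentiable
  potentials;
* `bondCurrentZ_embed`, `energyDensityZ_embed` — through the window embedding these are the finite-chain
  bond current / a polynomial in three sites;
* `pinnedChain_abs_bondCurrent_le_pow`, `pinnedChain_abs_energyDensityZ_embed_le` — polynomial bounds
  `C(1 + ‖x‖)⁴` for the pinned chain with ARBITRARY real parameters.

Nothing here closes an item.
-/

noncomputable section

namespace Summit.AtomisticToContinuum.FouriersLaw.Theorems.WindowLimit

open MeasureTheory Filter Topology Set
open scoped ContDiff
open Literature.MathematicalPhysics.KineticTheory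
open Literature.MathematicalPhysics.KineticTheory.HeatConduction

variable {N : ℕ}

/-! ### The continuity equation `𝒜 h_x = j_{x-1} - j_x` -/

section Continuity

variable (P : OscillatorChain)

/-- `∂_{q_x} h_x = U'(q_x) + (-V'(q_{x+1} - q_x) + V'(q_x - q_{x-1}))/2`. [folklore] -/
theorem partialQZ_energyDensityZ_self (hU : Differentiable ℝ P.U) (hV : Differentiable ℝ P.V)
    (σ : ChainConfig) (x : ℤ) :
    partialQZ x (fun σ => P.energyDensityZ σ x) σ =
      deriv P.U (σ x).1 +
        (-deriv P.V ((σ (x + 1)).1 - (σ x).1) + deriv P.V ((σ x).1 - (σ (x - 1)).1)) / 2 := by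
  unfold partialQZ OscillatorChain.energyDensityZ
  have h2 : ∀ t, Function.update σ x (t, (σ x).2) (x + 1) = σ (x + 1) := fun t =>
    Function.update_of_ne (by omega) _ _
  have h3 : ∀ t, Function.update σ x (t, (σ x).2) (x - 1) = σ (x - 1) := fun t =>
    Function.update_of_ne (by omega) _ _
  simp only [Function.update_self, h2, h3]
  have hd : HasDerivAt (fun t => (σ x).2 ^ 2 / 2 + P.U t +
      (P.V ((σ (x + 1)).1 - t) + P.V (t - (σ (x - 1)).1)) / 2)
      (0 + deriv P.U (σ x).1 + (deriv P.V ((σ (x + 1)).1 - (σ x).1) * (0 - 1) +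
        deriv P.V ((σ x).1 - (σ (x - 1)).1) * (1 - 0)) / 2) (σ x).1 := by
    refine ((hasDerivAt_const _ _).add (hU _).hasDerivAt).add (HasDerivAt.div_const (HasDerivAt.add ?_ ?_) 2)
    · exact (hV _).hasDerivAt.comp _ ((hasDerivAt_const _ _).sub (hasDerivAt_id _))
    · exact (hV _).hasDerivAt.comp _ ((hasDerivAt_id _).sub (hasDerivAt_const _ _))
  rw [hd.deriv]
  ring

/-- `∂_{q_{x+1}} h_x = V'(q_{x+1} - q_x)/2`. [folklore] -/
theorem partialQZ_energyDensityZ_succ (hV : Differentiable ℝ P.V) (σ : ChainConfig) (x : ℤ) :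
    partialQZ (x + 1) (fun σ => P.energyDensityZ σ x) σ = deriv P.V ((σ (x + 1)).1 - (σ x).1) / 2 := by
  unfold partialQZ OscillatorChain.energyDensityZ
  have h1 : ∀ t, Function.update σ (x + 1) (t, (σ (x + 1)).2) x = σ x := fun t =>
    Function.update_of_ne (by omega) _ _
  have h3 : ∀ t, Function.update σ (x + 1) (t, (σ (x + 1)).2) (x - 1) = σ (x - 1) := fun t =>
    Function.update_of_ne (by omega) _ _
  simp only [Function.update_self, h1, h3]
  have hd : HasDerivAt (fun t => (σ x).2 ^ 2 / 2 + P.U (σ x).1 +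
      (P.V (t - (σ x).1) + P.V ((σ x).1 - (σ (x - 1)).1)) / 2)
      (0 + (deriv P.V ((σ (x + 1)).1 - (σ x).1) * (1 - 0) + 0) / 2) (σ (x + 1)).1 := by
    refine (hasDerivAt_const _ _).add (HasDerivAt.div_const (HasDerivAt.add ?_ (hasDerivAt_const _ _)) 2)
    exact (hV _).hasDerivAt.comp _ ((hasDerivAt_id _).sub (hasDerivAt_const _ _))
  rw [hd.deriv]
  ring

/-- `∂_{q_{x-1}} h_x = -V'(q_x - q_{x-1})/2`. [folklore] -/
theorem partialQZ_energyDensityZ_pred (hV : Differentiable ℝ P.V) (σ : ChainConfig) (x : ℤ) :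
    partialQZ (x - 1) (fun σ => P.energyDensityZ σ x) σ = -deriv P.V ((σ x).1 - (σ (x - 1)).1) / 2 := by
  unfold partialQZ OscillatorChain.energyDensityZ
  have h1 : ∀ t, Function.update σ (x - 1) (t, (σ (x - 1)).2) x = σ x := fun t =>
    Function.update_of_ne (by omega) _ _
  have h2 : ∀ t, Function.update σ (x - 1) (t, (σ (x - 1)).2) (x + 1) = σ (x + 1) := fun t =>
    Function.update_of_ne (by omega) _ _
  simp only [Function.update_self, h1, h2]
  have hd : HasDerivAt (fun t => (σ x).2 ^ 2 / 2 + P.U (σ x).1 +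
      (P.V ((σ (x + 1)).1 - (σ x).1) + P.V ((σ x).1 - t)) / 2)
      (0 + (0 + deriv P.V ((σ x).1 - (σ (x - 1)).1) * (0 - 1)) / 2) (σ (x - 1)).1 := by
    refine (hasDerivAt_const _ _).add (HasDerivAt.div_const (HasDerivAt.add (hasDerivAt_const _ _) ?_) 2)
    exact (hV _).hasDerivAt.comp _ ((hasDerivAt_const _ _).sub (hasDerivAt_id _))
  rw [hd.deriv]
  ring

/-- Off the three sites `x-1, x, x+1`, `∂_{q_z} h_x = 0` and `∂_{p_z} h_x = 0`. [folklore] -/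
theorem partialZ_energyDensityZ_of_ne (σ : ChainConfig) (x : ℤ) {z : ℤ} (h0 : z ≠ x) (h1 : z ≠ x + 1)
    (h2 : z ≠ x - 1) :
    partialQZ z (fun σ => P.energyDensityZ σ x) σ = 0 ∧ partialPZ z (fun σ => P.energyDensityZ σ x) σ = 0 := by
  unfold partialQZ partialPZ OscillatorChain.energyDensityZ
  simp only [Function.update_of_ne h0.symm, Function.update_of_ne h1.symm, Function.update_of_ne h2.symm,
    deriv_const]
  exact ⟨trivial, trivial⟩

/-- `∂_{p_x} h_x = p_x`. [folklore] -/
theorem partialPZ_energyDensityZ_self (σ : ChainConfig) (x : ℤ) :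
    partialPZ x (fun σ => P.energyDensityZ σ x) σ = (σ x).2 := by
  unfold partialPZ OscillatorChain.energyDensityZ
  have h2 : ∀ t, Function.update σ x ((σ x).1, t) (x + 1) = σ (x + 1) := fun t =>
    Function.update_of_ne (by omega) _ _
  have h3 : ∀ t, Function.update σ x ((σ x).1, t) (x - 1) = σ (x - 1) := fun t =>
    Function.update_of_ne (by omega) _ _
  simp only [Function.update_self, h2, h3]
  have hd : HasDerivAt (fun t => t ^ 2 / 2 + P.U (σ x).1 +
      (P.V ((σ (x + 1)).1 - (σ x).1) + P.V ((σ x).1 - (σ (x - 1)).1)) / 2)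
      (2 * (σ x).2 ^ 1 * 1 / 2 + 0 + 0) (σ x).2 :=
    ((((hasDerivAt_id _).pow 2).div_const 2).add (hasDerivAt_const _ _)).add (hasDerivAt_const _ _)
  rw [hd.deriv]
  ring

/-- `∂_{p_z} h_x = 0` for `z ≠ x`. [folklore] -/
theorem partialPZ_energyDensityZ_of_ne (σ : ChainConfig) (x : ℤ) {z : ℤ} (h0 : z ≠ x) :
    partialPZ z (fun σ => P.energyDensityZ σ x) σ = 0 := by
  unfold partialPZ OscillatorChain.energyDensityZ
  by_cases h1 : z = x + 1
  · subst h1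
    have ha : ∀ t, Function.update σ (x + 1) ((σ (x + 1)).1, t) x = σ x := fun t =>
      Function.update_of_ne (by omega) _ _
    have hb : ∀ t, Function.update σ (x + 1) ((σ (x + 1)).1, t) (x - 1) = σ (x - 1) := fun t =>
      Function.update_of_ne (by omega) _ _
    simp only [Function.update_self, ha, hb, deriv_const]
  by_cases h2 : z = x - 1
  · subst h2
    have ha : ∀ t, Function.update σ (x - 1) ((σ (x - 1)).1, t) x = σ x := fun t =>
      Function.update_of_ne (by omega) _ _
    have hb : ∀ t, Function.update σ (x - 1) ((σ (x - 1)).1, t) (x + 1) = σ (x + 1) := fun t =>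
      Function.update_of_ne (by omega) _ _
    simp only [Function.update_self, ha, hb, deriv_const]
  simp only [Function.update_of_ne (Ne.symm h0), Function.update_of_ne (Ne.symm h1),
    Function.update_of_ne (Ne.symm h2), deriv_const]

/-- **The continuity equation of the infinite chain (generator form)**: for differentiable potentials,
`𝒜 h_x = j_{x-1} - j_x`, with `h_x` the energy density (bond energies split evenly) and
`j_x = -½(p_x + p_{x+1}) V'(q_{x+1} - q_x)` the bond current.
[Bonetto–Lebowitz–Rey-Bellet 2000, §5.2 eqs. (23)–(24)] [folklore] -/
theorem liouvilleZ_energyDensityZ (hU : Differentiable ℝ P.U) (hV : Differentiable ℝ P.V)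
    (σ : ChainConfig) (x : ℤ) :
    liouvilleZ P (fun σ => P.energyDensityZ σ x) σ = P.bondCurrentZ σ (x - 1) - P.bondCurrentZ σ x := by
  classical
  unfold liouvilleZ
  have hx1 : x - 1 ∉ ({x, x + 1} : Finset ℤ) := by simp; omega
  have hx0 : x ∉ ({x + 1} : Finset ℤ) := by simp
  rw [tsum_eq_sum (s := ({x - 1, x, x + 1} : Finset ℤ))]
  · rw [Finset.sum_insert hx1, Finset.sum_insert hx0, Finset.sum_singleton,
      partialQZ_energyDensityZ_self P hU hV, partialQZ_energyDensityZ_succ P hV,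
      partialQZ_energyDensityZ_pred P hV, partialPZ_energyDensityZ_self P,
      partialPZ_energyDensityZ_of_ne P σ x (show x + 1 ≠ x by omega),
      partialPZ_energyDensityZ_of_ne P σ x (show x - 1 ≠ x by omega)]
    simp only [OscillatorChain.force_eq, OscillatorChain.bondCurrentZ, sub_add_cancel]
    ring
  · intro z hz
    simp only [Finset.mem_insert, Finset.mem_singleton, not_or] at hz
    obtain ⟨h1, h2⟩ := partialZ_energyDensityZ_of_ne P σ x hz.2.1 hz.2.2 hz.1
    rw [h1, h2, mul_zero, mul_zero, add_zero]

/-- The energy density is a profile on the three-site box `{x-1, x, x+1}`. [folklore] -/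
theorem energyDensityZ_eq_comp_box (x : ℤ) :
    (fun σ => P.energyDensityZ σ x) =
      (fun y : Fin (2 + 1) → ℝ × ℝ => (y 1).2 ^ 2 / 2 + P.U (y 1).1 +
        (P.V ((y 2).1 - (y 1).1) + P.V ((y 1).1 - (y 0).1)) / 2) ∘ boxRestrictAt (x - 1) 2 := by
  funext σ
  simp only [Function.comp_apply, OscillatorChain.energyDensityZ, boxRestrictAt_apply, Fin.val_zero,
    Fin.val_one, Fin.val_two, Nat.cast_zero, Nat.cast_one, Nat.cast_ofNat, add_zero, sub_add_cancel]
  have h2 : x - 1 + 2 = x + 1 := by ring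
  rw [h2]

end Continuity

/-! ### Bond currents and energy densities through the embedding -/

/-- The finite-chain bond current has a single term: `j_i = -½(p_i + p_{i+1}) V'(q_{i+1} - q_i)` for a
genuine bond, `0` for the last site. [folklore] -/
theorem bondCurrent_eq_dite (P : OscillatorChain) (N : ℕ) (i : Fin N) (x : PhaseSpace N) :
    P.bondCurrent N i x = if h : i.val + 1 < N then
      -((x.2 i + x.2 ⟨i.val + 1, h⟩) / 2 * deriv P.V (x.1 ⟨i.val + 1, h⟩ - x.1 i)) else 0 := by
  unfold OscillatorChain.bondCurrent
  split_ifs with h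
  · rw [Finset.sum_eq_single_of_mem (⟨i.val + 1, h⟩ : Fin N) (Finset.mem_univ _)]
    · simp
    · intro b _ hb
      rw [if_neg]
      intro hb'
      exact hb (Fin.ext hb')
  · refine Finset.sum_eq_zero fun j _ => ?_
    rw [if_neg]
    intro hj
    exact h (hj ▸ j.isLt)

/-- **Through the embedding the infinite-chain bond current is the finite-chain bond current**:
`j_{j-c}(embed x) = j_j(x)` for a genuine bond `(j, j+1)`. [folklore] -/
theorem bondCurrentZ_embed (P : OscillatorChain) (N c : ℕ) (x : PhaseSpace N) (j : Fin N) (hj : j.val + 1 < N) :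
    P.bondCurrentZ (embed N c x) ((j : ℤ) - c) = P.bondCurrent N j x := by
  rw [bondCurrent_eq_dite, dif_pos hj]
  unfold OscillatorChain.bondCurrentZ
  have e0 := embed_apply_fin N c x j
  have e1 : embed N c x ((j : ℤ) - c + 1) = (x.1 ⟨j.val + 1, hj⟩, x.2 ⟨j.val + 1, hj⟩) := by
    have h := embed_apply_fin N c x ⟨j.val + 1, hj⟩
    have hc : (((⟨j.val + 1, hj⟩ : Fin N) : ℕ) : ℤ) - c = (j : ℤ) - c + 1 := by push_cast; ring
    rwa [hc] at h
  rw [e0, e1]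

/-- The energy density of the embedded configuration at an interior site, in finite coordinates. [folklore] -/
theorem energyDensityZ_embed (P : OscillatorChain) (N c : ℕ) (x : PhaseSpace N) (j : Fin N) (hj1 : 1 ≤ j.val)
    (hj2 : j.val + 1 < N) :
    P.energyDensityZ (embed N c x) ((j : ℤ) - c) =
      x.2 j ^ 2 / 2 + P.U (x.1 j) +
        (P.V (x.1 ⟨j.val + 1, hj2⟩ - x.1 j) + P.V (x.1 j - x.1 ⟨j.val - 1, by omega⟩)) / 2 := by
  unfold OscillatorChain.energyDensityZ
  have e0 := embed_apply_fin N c x j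
  have e1 : embed N c x ((j : ℤ) - c + 1) = (x.1 ⟨j.val + 1, hj2⟩, x.2 ⟨j.val + 1, hj2⟩) := by
    have h := embed_apply_fin N c x ⟨j.val + 1, hj2⟩
    have hc : (((⟨j.val + 1, hj2⟩ : Fin N) : ℕ) : ℤ) - c = (j : ℤ) - c + 1 := by push_cast; ring
    rwa [hc] at h
  have e2 : embed N c x ((j : ℤ) - c - 1) = (x.1 ⟨j.val - 1, by omega⟩, x.2 ⟨j.val - 1, by omega⟩) := by
    have h := embed_apply_fin N c x ⟨j.val - 1, by omega⟩
    have hc : (((⟨j.val - 1, by omega⟩ : Fin N) : ℕ) : ℤ) - c = (j : ℤ) - c - 1 := by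
      have : ((j.val - 1 : ℕ) : ℤ) = (j.val : ℤ) - 1 := by omega
      simp only [this]; ring
    rwa [hc] at h
  rw [e0, e1, e2]

/-! ### Bulk bond currents of a steady state of the pinned chain agree -/

section Pinned

variable {ω₂ lam β γ : ℝ}

/-- `|V'(r)| = |r + βr³| ≤ (2 + 8|β|)(1 + ‖x‖)³` for a bond stretch `r = q_j - q_i`. [folklore] -/
theorem pinnedChain_abs_deriv_V_sub_le (β : ℝ) (ω₂ lam γ : ℝ) (x : PhaseSpace N) (i j : Fin N) :
    |deriv (pinnedChain ω₂ lam β γ).V (x.1 j - x.1 i)| ≤ (2 + 8 * |β|) * (1 + ‖x‖) ^ 3 := by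
  rw [pinnedChain_deriv_V]
  exact abs_deriv_V_bound (norm_nonneg x) (abs_sub_coord_le x i j)

/-- **Polynomial bound for the bond current**: `|j_j(x)| ≤ (2 + 8|β|)(1 + ‖x‖)⁴`. [folklore] -/
theorem pinnedChain_abs_bondCurrent_le_pow (ω₂ lam β γ : ℝ) (x : PhaseSpace N) (j : Fin N) :
    |(pinnedChain ω₂ lam β γ).bondCurrent N j x| ≤ (2 + 8 * |β|) * (1 + ‖x‖) ^ 4 := by
  rw [bondCurrent_eq_dite]
  split_ifs with h
  · have hp1 := (abs_coord_le_norm x j).2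
    have hp2 := (abs_coord_le_norm x ⟨j.val + 1, h⟩).2
    have hs : 0 ≤ ‖x‖ := norm_nonneg _
    have hV := pinnedChain_abs_deriv_V_sub_le β ω₂ lam γ x j ⟨j.val + 1, h⟩
    rw [abs_neg, abs_mul, abs_div, abs_two]
    have hsum : |x.2 j + x.2 ⟨j.val + 1, h⟩| / 2 ≤ 1 + ‖x‖ := by
      have := abs_add_le (x.2 j) (x.2 ⟨j.val + 1, h⟩)
      linarith
    calc |x.2 j + x.2 ⟨j.val + 1, h⟩| / 2 * |deriv (pinnedChain ω₂ lam β γ).V (x.1 ⟨j.val + 1, h⟩ - x.1 j)|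
        ≤ (1 + ‖x‖) * ((2 + 8 * |β|) * (1 + ‖x‖) ^ 3) := mul_le_mul hsum hV (abs_nonneg _) (by positivity)
      _ = (2 + 8 * |β|) * (1 + ‖x‖) ^ 4 := by ring
  · rw [abs_zero]; positivity

/-- **Polynomial bound for the energy density at an interior site of the embedded configuration**:
`|h_{j-c}(embed x)| ≤ (1 + |ω₂| + |lam| + 4 + 8|β|)(1 + ‖x‖)⁴`. [folklore] -/
theorem pinnedChain_abs_energyDensityZ_embed_le (ω₂ lam β γ : ℝ) (N c : ℕ) (x : PhaseSpace N) (j : Fin N)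
    (hj1 : 1 ≤ j.val) (hj2 : j.val + 1 < N) :
    |(pinnedChain ω₂ lam β γ).energyDensityZ (embed N c x) ((j : ℤ) - c)| ≤
      (1 + |ω₂| + |lam| + 4 + 8 * |β|) * (1 + ‖x‖) ^ 4 := by
  rw [energyDensityZ_embed _ N c x j hj1 hj2]
  set s := ‖x‖ with hs
  have hs0 : 0 ≤ s := norm_nonneg _
  have h1 : (1:ℝ) ≤ 1 + s := by linarith
  have hq := (abs_coord_le_norm x j).1
  have hp := (abs_coord_le_norm x j).2
  have hr1 := abs_sub_coord_le x j ⟨j.val + 1, hj2⟩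
  have hr2 := abs_sub_coord_le x ⟨j.val - 1, by omega⟩ j
  -- monomial bounds by powers of `1 + s`
  have hp2 : x.2 j ^ 2 / 2 ≤ (1 + s) ^ 4 := by
    have : x.2 j ^ 2 ≤ (1 + s) ^ 2 := by
      rw [← sq_abs]; exact pow_le_pow_left₀ (abs_nonneg _) (by linarith) 2
    nlinarith [pow_le_pow_right₀ h1 (show 2 ≤ 4 by norm_num)]
  have hU : |(pinnedChain ω₂ lam β γ).U (x.1 j)| ≤ (|ω₂| + |lam|) * (1 + s) ^ 4 := by
    show |ω₂ * x.1 j ^ 2 / 2 + lam * x.1 j ^ 4 / 4| ≤ _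
    have hq2 : x.1 j ^ 2 ≤ (1 + s) ^ 4 := by
      have : x.1 j ^ 2 ≤ (1 + s) ^ 2 := by
        rw [← sq_abs]; exact pow_le_pow_left₀ (abs_nonneg _) (by linarith) 2
      exact this.trans (pow_le_pow_right₀ h1 (by norm_num))
    have hq4 : x.1 j ^ 4 ≤ (1 + s) ^ 4 := by
      rw [show x.1 j ^ 4 = |x.1 j| ^ 4 by rw [pow_abs, abs_of_nonneg (by positivity)]]
      exact pow_le_pow_left₀ (abs_nonneg _) (by linarith) 4
    calc |ω₂ * x.1 j ^ 2 / 2 + lam * x.1 j ^ 4 / 4| ≤ |ω₂| * x.1 j ^ 2 / 2 + |lam| * x.1 j ^ 4 / 4 := by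
          refine (abs_add_le _ _).trans ?_
          rw [abs_div, abs_div, abs_mul, abs_mul, abs_of_nonneg (sq_nonneg (x.1 j)),
            abs_of_nonneg (by positivity : (0:ℝ) ≤ x.1 j ^ 4), abs_two,
            abs_of_nonneg (by norm_num : (0:ℝ) ≤ 4)]
      _ ≤ |ω₂| * (1 + s) ^ 4 + |lam| * (1 + s) ^ 4 := by
          have a1 := mul_le_mul_of_nonneg_left hq2 (abs_nonneg ω₂)
          have a2 := mul_le_mul_of_nonneg_left hq4 (abs_nonneg lam)
          nlinarith [abs_nonneg ω₂, abs_nonneg lam, pow_nonneg (by linarith : (0:ℝ) ≤ 1 + s) 4]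
      _ = (|ω₂| + |lam|) * (1 + s) ^ 4 := by ring
  have hVb : ∀ r : ℝ, |r| ≤ 2 * s → |(pinnedChain ω₂ lam β γ).V r| ≤ (2 + 4 * |β|) * (1 + s) ^ 4 := by
    intro r hr
    show |r ^ 2 / 2 + β * r ^ 4 / 4| ≤ _
    have hr2 : r ^ 2 ≤ 4 * (1 + s) ^ 4 := by
      have : r ^ 2 ≤ (2 * s) ^ 2 := by rw [← sq_abs]; exact pow_le_pow_left₀ (abs_nonneg _) hr 2
      nlinarith [pow_le_pow_right₀ h1 (show 2 ≤ 4 by norm_num), pow_le_pow_left₀ hs0 (by linarith : s ≤ 1 + s) 2]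
    have hr4 : r ^ 4 ≤ 16 * (1 + s) ^ 4 := by
      have : r ^ 4 ≤ (2 * s) ^ 4 := by
        rw [show r ^ 4 = |r| ^ 4 by rw [pow_abs, abs_of_nonneg (by positivity)]]
        exact pow_le_pow_left₀ (abs_nonneg _) hr 4
      nlinarith [pow_le_pow_left₀ hs0 (by linarith : s ≤ 1 + s) 4]
    calc |r ^ 2 / 2 + β * r ^ 4 / 4| ≤ r ^ 2 / 2 + |β| * r ^ 4 / 4 := by
          refine (abs_add_le _ _).trans ?_
          rw [abs_div, abs_div, abs_mul, abs_of_nonneg (sq_nonneg r),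
            abs_of_nonneg (by positivity : (0:ℝ) ≤ r ^ 4), abs_two, abs_of_nonneg (by norm_num : (0:ℝ) ≤ 4)]
      _ ≤ 4 * (1 + s) ^ 4 / 2 + |β| * (16 * (1 + s) ^ 4) / 4 := by
          have := mul_le_mul_of_nonneg_left hr4 (abs_nonneg β)
          nlinarith
      _ = (2 + 4 * |β|) * (1 + s) ^ 4 := by ring
  have hV1 := hVb _ hr1
  have hV2 := hVb _ hr2
  calc _ ≤ |x.2 j ^ 2 / 2 + (pinnedChain ω₂ lam β γ).U (x.1 j)| +
        |((pinnedChain ω₂ lam β γ).V (x.1 ⟨j.val + 1, hj2⟩ - x.1 j) +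
          (pinnedChain ω₂ lam β γ).V (x.1 j - x.1 ⟨j.val - 1, by omega⟩)) / 2| := abs_add_le _ _
    _ ≤ ((1 + s) ^ 4 + (|ω₂| + |lam|) * (1 + s) ^ 4) + ((2 + 4 * |β|) * (1 + s) ^ 4) := by
        refine add_le_add ((abs_add_le _ _).trans (add_le_add ?_ hU)) ?_
        · rw [abs_of_nonneg (by positivity)]; exact hp2
        · rw [abs_div, abs_two]
          have := abs_add_le ((pinnedChain ω₂ lam β γ).V (x.1 ⟨j.val + 1, hj2⟩ - x.1 j))
            ((pinnedChain ω₂ lam β γ).V (x.1 j - x.1 ⟨j.val - 1, by omega⟩))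
          linarith
    _ ≤ (1 + |ω₂| + |lam| + 4 + 8 * |β|) * (1 + s) ^ 4 := by
        nlinarith [pow_nonneg (by linarith : (0:ℝ) ≤ 1 + s) 4, abs_nonneg β]

end Pinned

end Summit.AtomisticToContinuum.FouriersLaw.Theorems.WindowLimit

end
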